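import Mathlib.Tactic
import HarnessLib
import HarnessLib.Audit.Tags
import Summits.CriticalPhenomena.PercolationContinuityZ3.Theorems.PercNearOneGluingNoHeavyLowerTailSahiAntichainSixStructure
import Summits.CriticalPhenomena.PercolationContinuityZ3.Theorems.PercNearOneGluingNoHeavyLowerTailSahiAntichainSixShape
import Summits.CriticalPhenomena.PercolationContinuityZ3.Theorems.PercNearOneGluingNoHeavyLowerTailSahiAntichainBlowupSide

/-!
# Antichains, meets plus joins: **the `C([4],2)` structure theorem, L4, and V5**

Support file (seat `prim-masterthm-p1`, gen 38; `--supports stmt-CriticalPhenomena-4575`).  No `sorry`, no new definitions, standard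
axioms.  Memo `run/shared/lean/prim/prim-masterthm/FROM-prim-masterthm-p1-g38-BLOWUP-SIDE.md`.

MAIN RESULTS ([this work], gen 38).
* `exists_blowup_of_six`: **a six-member antichain in which every effective point has exactly three members above it, forming a
  sunflower, is a blow-up of `C([4],2)`**: `A = {K ∪ B i ∪ B j : i ≠ j}` for four non-empty pairwise disjoint blocks disjoint from `K`,
  where `K` is the common part of the members.  (Construction: a member `a₁`, its two triples with cores `M₁, M₂`, the sixth member `e`
  and its two triples with cores `M₃, M₄`; `K = a₁ ∩ e`, `B i = M i \ K`; `…SixStructure` supplies the combinatorics.)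
* `four_le_newLabels_of_six_le_eleven` — **L4**: a six-member side `above P r` with at most eleven labels of its own creates at least
  four new labels (`…SixPrep`, `…SixShape` give the hypotheses of the structure theorem; `four_le_newLabels_of_blowup`, `…BlowupSide`,
  is the blow-up side lemma).
* Consequently (`two_mul_card_le_of_L4` and its companions, `…TwoThreeA`) the conjectures of this series are THEOREMS:
  **V5** `two_mul_card_le_add_two : 2 #P ≤ #meets P + #joins P + 2` for every finite antichain of finite sets; the linear form
  `two_mul_card_le_of_seven_le : 7 ≤ #P → 2 #P ≤ #meets P + #joins P`; **V1** `card_le_meets_or_joins : #P ≤ #meets P + 1 ∨ #P ≤ #joins P + 1`;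
  and the typed statements `AntichainSmallSide`, `AntichainMidRange` (`…Linear`) hold (`antichainSmallSide_holds`, `antichainMidRange_holds`).
V5 is the sharp linear case (`R = 2`) of Conjecture 7.2 of Kahn–Saks, *On the widths of finite distributive lattices*, Discrete Math. 63
(1987), for the one-step closure `H(𝒴)` (pairwise unions and intersections of an antichain); equality holds for two members, the
three-member (co)sunflowers and the blow-ups of `C([4],2)`.
HONEST FRAMING: unconditional theorems; `AntichainMeetsOrJoins` / `IsolatedRainbow` (the boundary cases with `∅`, `F` among the labels)
are not treated here. [this work]
-/

namespace Summit.CriticalPhenomena.PercolationContinuityZ3.Theorems.SahiColouredDaykin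

open Finset

variable {α : Type*} [DecidableEq α]

/-! ### 1. Two triples of a member meet the two triples of its antipode -/

section Triples

variable {A : Finset (Finset α)}

/-- If the triple `above A p ∋ a₁` avoids `e ∈ above A q''`, and every member of `above A p` other than `a₁` lies in `T'` or in
`above A q''`, then some member of `above A p` lies in `T'`. [this work] -/
theorem exists_mem_above_mem (h3 : ∀ s ∈ effPoints A, #(above A s) = 3) {p q'' : α} {Mp Mq'' : Finset α}
    (hp : p ∈ effPoints A) (hq'' : q'' ∈ effPoints A)
    (hMp : ∀ a ∈ above A p, ∀ a' ∈ above A p, a ≠ a' → a ∩ a' = Mp)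
    (hMq'' : ∀ a ∈ above A q'', ∀ a' ∈ above A q'', a ≠ a' → a ∩ a' = Mq'')
    {a₁ e : Finset α} {T' : Finset (Finset α)} (ha₁ : a₁ ∈ above A p) (he'' : e ∈ above A q'') (heT : e ∉ above A p)
    (hsplit : ∀ d ∈ above A p, d ≠ a₁ → d ∈ T' ∨ d ∈ above A q'') : ∃ d, d ∈ above A p ∧ d ∈ T' := by
  by_contra hno
  push Not at hno
  have hcard : #((above A p).erase a₁) = 2 := by rw [card_erase_of_mem ha₁, h3 p hp]
  obtain ⟨u, v, hu, hv, huv⟩ := one_lt_card_iff.1 (by omega : 1 < #((above A p).erase a₁))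
  obtain ⟨hua, huT⟩ := mem_erase.1 hu
  obtain ⟨hva, hvT⟩ := mem_erase.1 hv
  have hu'' : u ∈ above A q'' := (hsplit u huT hua).resolve_left (hno u huT)
  have hv'' : v ∈ above A q'' := (hsplit v hvT hva).resolve_left (hno v hvT)
  have hM : Mp = Mq'' := (hMp u huT v hvT huv).symm.trans (hMq'' u hu'' v hv'' huv)
  have hpM : p ∈ Mq'' := hM ▸ mem_core_of_above_eq (h3 p hp) hMp rfl
  have := above_eq_of_mem_core h3 hq'' hMq'' hpM hp
  exact heT (this ▸ he'')

/-! ### 2. The structure theorem -/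

/-- **The `C([4],2)` structure theorem.**  A six-member antichain in which every effective point has exactly three members above it, with
all their pairwise meets equal, is `{K ∪ B i ∪ B j : i ≠ j}` for a set `K` (the common part) and four non-empty, pairwise disjoint blocks
disjoint from `K`. [this work] -/
theorem exists_blowup_of_six (hanti : IsAntichain (· ⊆ ·) (A : Set (Finset α))) (h6 : #A = 6)
    (h3 : ∀ s ∈ effPoints A, #(above A s) = 3)
    (hS : ∀ s ∈ effPoints A, ∃ M, ∀ a ∈ above A s, ∀ a' ∈ above A s, a ≠ a' → a ∩ a' = M) :
    ∃ (K : Finset α) (B : Fin 4 → Finset α), (∀ i, (B i).Nonempty) ∧ (∀ i, Disjoint K (B i)) ∧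
      (∀ i j, i ≠ j → Disjoint (B i) (B j)) ∧ (∀ a, a ∈ A ↔ ∃ i j, i ≠ j ∧ a = K ∪ B i ∪ B j) ∧
      (∀ x, (∀ a ∈ A, x ∈ a) → x ∈ K) := by
  -- a member `a₁`, its two triples, the sixth member `e`, its two triples
  obtain ⟨a₁, ha₁⟩ : A.Nonempty := card_pos.1 (by omega)
  obtain ⟨p₁, p₂, hp₁, hp₂, h11, h12, hne12⟩ := exists_two_triples hanti h6 h3 hS ha₁
  obtain ⟨M₁, hM₁⟩ := hS p₁ hp₁
  obtain ⟨M₂, hM₂⟩ := hS p₂ hp₂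
  have only12 : ∀ b ∈ above A p₁, b ∈ above A p₂ → b = a₁ :=
    fun b hb hb' => eq_of_mem_two_above h3 hp₁ hp₂ hM₁ hM₂ h11 h12 hne12 hb hb'
  obtain ⟨e, heA, he1, he2, uniq12⟩ := exists_sixth h6 (h3 p₁ hp₁) (h3 p₂ hp₂) h11 h12 only12
  obtain ⟨p₃, p₄, hp₃, hp₄, h33, h34, hne34⟩ := exists_two_triples hanti h6 h3 hS heA
  obtain ⟨M₃, hM₃⟩ := hS p₃ hp₃
  obtain ⟨M₄, hM₄⟩ := hS p₄ hp₄
  -- the common part `K = a₁ ∩ e`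
  have hKsub : ∀ g ∈ A, a₁ ∩ e ⊆ g := fun g hg z hz =>
    forall_mem_of_mem_inter_sixth h6 h3 hS hp₁ hp₂ hM₁ hM₂ h11 h12 hne12 heA he1 he2 (mem_inter.1 hz).1 (mem_inter.1 hz).2 g hg
  have hKall : ∀ x, (∀ g ∈ A, x ∈ g) → x ∈ a₁ ∩ e := fun x hx => mem_inter.2 ⟨hx a₁ ha₁, hx e heA⟩
  -- effective points are not common points
  have neff : ∀ {s : α}, s ∈ effPoints A → ¬ ∀ g ∈ A, s ∈ g := by
    intro s hs hall
    obtain ⟨_, ⟨g, hg⟩⟩ := mem_effPoints_iff.1 hs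
    exact (mem_below_iff.1 hg).2 (hall g (mem_below_iff.1 hg).1)
  -- `a₁` avoids the triples of `e`
  have ha3 : a₁ ∉ above A p₃ := fun h =>
    neff hp₃ fun g hg => hKsub g hg (mem_inter.2 ⟨(mem_above_iff.1 h).2, (mem_above_iff.1 h33).2⟩)
  have ha4 : a₁ ∉ above A p₄ := fun h =>
    neff hp₄ fun g hg => hKsub g hg (mem_inter.2 ⟨(mem_above_iff.1 h).2, (mem_above_iff.1 h34).2⟩)
  have only34 : ∀ b ∈ above A p₃, b ∈ above A p₄ → b = e :=
    fun b hb hb' => eq_of_mem_two_above h3 hp₃ hp₄ hM₃ hM₄ h33 h34 hne34 hb hb'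
  obtain ⟨e', _, _, _, uniq34⟩ := exists_sixth h6 (h3 p₃ hp₃) (h3 p₄ hp₄) h33 h34 only34
  have hea : e' = a₁ := (uniq34 a₁ ha₁ ha3 ha4).symm
  -- every member other than `e` is in a triple of `a₁`, every member other than `a₁` in a triple of `e`
  have cov12 : ∀ d ∈ A, d ≠ e → d ∈ above A p₁ ∨ d ∈ above A p₂ := by
    intro d hd hde; by_contra h; rw [not_or] at h; exact hde (uniq12 d hd h.1 h.2)
  have cov34 : ∀ d ∈ A, d ≠ a₁ → d ∈ above A p₃ ∨ d ∈ above A p₄ := by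
    intro d hd hda; by_contra h; rw [not_or] at h; exact hda (hea ▸ uniq34 d hd h.1 h.2)
  -- pairwise different triples
  have n13 : above A p₁ ≠ above A p₃ := fun h => ha3 (h ▸ h11)
  have n14 : above A p₁ ≠ above A p₄ := fun h => ha4 (h ▸ h11)
  have n23 : above A p₂ ≠ above A p₃ := fun h => ha3 (h ▸ h12)
  have n24 : above A p₂ ≠ above A p₄ := fun h => ha4 (h ▸ h12)
  -- members common to a triple of `a₁` and a triple of `e`
  have m13 := exists_mem_above_mem h3 hp₁ hp₄ hM₁ hM₄ h11 h34 he1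
    (fun d hd hda => cov34 d (above_subset A _ hd) hda)
  have m14 := exists_mem_above_mem h3 hp₁ hp₃ hM₁ hM₃ h11 h33 he1
    (fun d hd hda => (cov34 d (above_subset A _ hd) hda).symm)
  have m23 := exists_mem_above_mem h3 hp₂ hp₄ hM₂ hM₄ h12 h34 he2
    (fun d hd hda => cov34 d (above_subset A _ hd) hda)
  have m24 := exists_mem_above_mem h3 hp₂ hp₃ hM₂ hM₃ h12 h33 he2
    (fun d hd hda => (cov34 d (above_subset A _ hd) hda).symm)
  -- the generic assembly
  have main := blowup_of_four_triples h6 h3 hS ![p₁, p₂, p₃, p₄] ![M₁, M₂, M₃, M₄]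
    (by intro i; fin_cases i <;> assumption)
    (by intro i; fin_cases i <;> assumption)
    (by
      intro i j hij
      fin_cases i <;> fin_cases j
      all_goals first
        | exact absurd rfl hij
        | exact hne12 | exact hne12.symm | exact hne34 | exact hne34.symm
        | exact n13 | exact n13.symm | exact n14 | exact n14.symm
        | exact n23 | exact n23.symm | exact n24 | exact n24.symm)
    (a₁ ∩ e) hKsub hKall
    (by
      intro i
      fin_cases i
      · exact fun h => he1 (mem_above_iff.2 ⟨heA, (mem_inter.1 h).2⟩)
      · exact fun h => he2 (mem_above_iff.2 ⟨heA, (mem_inter.1 h).2⟩)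
      · exact fun h => ha3 (mem_above_iff.2 ⟨ha₁, (mem_inter.1 h).1⟩)
      · exact fun h => ha4 (mem_above_iff.2 ⟨ha₁, (mem_inter.1 h).1⟩))
    (by
      intro d hd
      by_cases hda : d = a₁
      · subst hda; exact ⟨0, 1, by decide, h11, h12⟩
      by_cases hde : d = e
      · subst hde; exact ⟨2, 3, by decide, h33, h34⟩
      rcases cov12 d hd hde with h | h <;> rcases cov34 d hd hda with h' | h'
      · exact ⟨0, 2, by decide, h, h'⟩
      · exact ⟨0, 3, by decide, h, h'⟩
      · exact ⟨1, 2, by decide, h, h'⟩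
      · exact ⟨1, 3, by decide, h, h'⟩)
    (by
      intro i j hij
      fin_cases i <;> fin_cases j
      all_goals first
        | exact absurd rfl hij
        | exact ⟨a₁, h11, h12⟩ | exact ⟨a₁, h12, h11⟩ | exact ⟨e, h33, h34⟩ | exact ⟨e, h34, h33⟩
        | exact m13 | exact m14 | exact m23 | exact m24
        | (obtain ⟨d, hd, hd'⟩ := m13; exact ⟨d, hd', hd⟩)
        | (obtain ⟨d, hd, hd'⟩ := m14; exact ⟨d, hd', hd⟩)
        | (obtain ⟨d, hd, hd'⟩ := m23; exact ⟨d, hd', hd⟩)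
        | (obtain ⟨d, hd, hd'⟩ := m24; exact ⟨d, hd', hd⟩))
  obtain ⟨hne, hKB, hdis, hmem⟩ := main
  exact ⟨a₁ ∩ e, fun i => ![M₁, M₂, M₃, M₄] i \ (a₁ ∩ e), hne, hKB, hdis, hmem, hKall⟩

end Triples

/-! ### 3. L4 and V5 -/

/-- **L4.**  A six-member side `above P r` with at most eleven labels of its own, against a non-empty other side, creates at least
four new labels. [this work] -/
theorem four_le_newLabels_of_six_le_eleven {P : Finset (Finset α)} {r : α} (hanti : IsAntichain (· ⊆ ·) (P : Set (Finset α)))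
    (h6 : #(above P r) = 6) (hB : (below P r).Nonempty)
    (hf : #(meets (above P r)) + #(joins (above P r)) ≤ 11) : 4 ≤ newLabels P r := by
  have hantiA := isAntichain_above hanti r
  have h3 : ∀ s ∈ effPoints (above P r), #(above (above P r) s) = 3 :=
    fun s hs => (card_above_eq_three_of_six_le_eleven hantiA h6 hf hs).1
  have hS : ∀ s ∈ effPoints (above P r), ∃ M, ∀ a ∈ above (above P r) s, ∀ a' ∈ above (above P r) s,
      a ≠ a' → a ∩ a' = M := fun s hs => exists_inter_eq_above_of_six_le_eleven hantiA h6 hf hs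
  obtain ⟨K, B, hne, hKB, hdis, hA, hK⟩ := exists_blowup_of_six hantiA h6 h3 hS
  have hr : r ∈ K := hK r fun a ha => (mem_above_iff.1 ha).2
  exact four_le_newLabels_of_blowup hanti hA hdis hKB hne hr hB

/-- **V5 (THEOREM).**  Every finite antichain of finite sets satisfies `2 #P ≤ #meets P + #joins P + 2`: the distinct pairwise
intersections and unions of distinct members number at least `2 #P − 2`.  Sharp for two members, three-member (co)sunflowers and the
blow-ups of `C([4],2)`; the linear case `R = 2` of Kahn–Saks' Conjecture 7.2 (1987) on `H(𝒴)`. [this work] -/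
theorem two_mul_card_le_add_two (P : Finset (Finset α)) (hanti : IsAntichain (· ⊆ ·) (P : Set (Finset α))) :
    2 * #P ≤ #(meets P) + #(joins P) + 2 :=
  two_mul_card_le_of_L4 (fun _ _ hQ h6 hB hf => four_le_newLabels_of_six_le_eleven hQ h6 hB hf) P hanti

/-- **The linear form (THEOREM)**: an antichain with at least seven members has `2 #P ≤ #meets P + #joins P`. [this work] -/
theorem two_mul_card_le_of_seven_le (P : Finset (Finset α)) (hanti : IsAntichain (· ⊆ ·) (P : Set (Finset α))) (h7 : 7 ≤ #P) :
    2 * #P ≤ #(meets P) + #(joins P) :=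
  two_mul_card_le_linear_of_L4 (fun _ _ hQ h6 hB hf => four_le_newLabels_of_six_le_eleven hQ h6 hB hf) P hanti h7

/-- **V1 (THEOREM)**: `#P ≤ #meets P + 1` or `#P ≤ #joins P + 1` for every antichain. [this work] -/
theorem card_le_meets_or_joins (P : Finset (Finset α)) (hanti : IsAntichain (· ⊆ ·) (P : Set (Finset α))) :
    #P ≤ #(meets P) + 1 ∨ #P ≤ #(joins P) + 1 :=
  card_le_or_card_le_of_L4 (fun _ _ hQ h6 hB hf => four_le_newLabels_of_six_le_eleven hQ h6 hB hf) P hanti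

/-- The typed statement `AntichainSmallSide` (`…Linear`) holds. [this work] -/
theorem antichainSmallSide_holds : AntichainSmallSide α :=
  antichainSmallSide_of_L4 fun _ _ hQ h6 hB hf =>
    (four_le_newLabels_of_six_le_eleven hQ h6 hB hf).trans' (by omega)

/-- The typed statement `AntichainMidRange` (`…Linear`) holds. [this work] -/
theorem antichainMidRange_holds : AntichainMidRange α :=
  antichainMidRange_of_L4 fun _ _ hQ h6 hB hf => four_le_newLabels_of_six_le_eleven hQ h6 hB hf

end Summit.CriticalPhenomena.PercolationContinuityZ3.Theorems.SahiColouredDaykin
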